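import Summits.ResolutionOfSingularities.ResolutionOfSingularities.Theorems.FrobeniusLadderFRationalResolutionDescendedPrimaryPieceCover
import Summits.ResolutionOfSingularities.ResolutionOfSingularities.Theorems.FrobeniusLadderFRationalResolutionGaloisUpstairsPiece
import HarnessLib

/-!
# Crux `FrobeniusLadder.FRationalResolution` (stmt-ResolutionOfSingularities-15317), line `redirect`,
# stub `stub_diagonalizableQuotientResolution` — the UPSTAIRS PIECE of the Galois route WITH ITS FLAT CHART COVER and the
# CENTRE EQUATION, on the chart `B' ⊗_B C` that carries the Galois action

`…GaloisUpstairsPiece.exists_piece_of_residue_embedding` (✓p834009) returns a `𝔔'`-primary piece `I₁ ⊆ B'` with `Bl_{I₁ B'_h}`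
regular and forgets the comparison with the chart centre `J`. The remaining obligation of the Galois route (memo
MEMO-15317-leafhand2-g13 §2: the twists `(1 ⊗ σ) I₁`, `σ` in the decomposition group of `𝔔'`, are effective Cartier on
`Bl_{I₁}(Spec B'_h)`) is to be verified after a flat surjective base change to the chart (`…BlowupCartierBaseChange` ✓p835409),
so the chart, the cover and the equation `I₁ · C'_G = J · C'_G` must be OUTPUT. This file re-assembles the upstairs piece directly on
the chart `C' = B' ⊗_B C` (no preliminary shrinking of `B'`: the point `𝔚` is unramified over `𝔭` because `B → B'` is unramified
at `𝔔'` and `B' → C'` is formally unramified), which is the ring on which `(1 ⊗ σ) ⊗ 1` acts for EVERY `σ`, and keeps: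
the trivial-residue point `𝔚`, one element `G ∉ 𝔚` with `𝔚 C'_G ⊆ 𝔭 C'_G` (over `D(G)` the fibre of `𝔭` — a fortiori of `𝔔'` —
is the reduced point `𝔚`) and `I C'_G = J C'_G`, and `h ∉ 𝔔'` with `D(h) ⊆ im (Spec C'_G → Spec B')` and `Bl_{I B'_h}` regular.
With `…DescendedPrimaryPieceCover.flat_specMap_awayMap / surjective_specMap_awayMap / map_awayMap_eq` this is literally the input of
`…BlowupCartierBaseChange.isEffectiveCartier_comap_affineBlowup_of_flat_surjective` for `B'_h → C'_{G h}`.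

* `map_atPrime_eq_maximalIdeal_of_tower` — unramifiedness of `𝔭` at `𝔚` from `𝔭 B'_{𝔔'} = 𝔔' B'_{𝔔'}` and `𝔔' C'_𝔚 = 𝔚 C'_𝔚`.
* **`exists_piece_cover`** — the statement above, the trivial-residue point `𝔚 ⊆ B' ⊗_B C` being an INPUT.
* `exists_piece_cover_of_residue_embedding` — the same from an embedding of residue fields `ι : C/𝔔 → B'/𝔔'` over `B`
  (the interface of `exists_piece_of_residue_embedding`), the point `𝔚` it determines being part of the output.

Honest label: plumbing toward ONE leaf stub (no stub, crux or summit closed). No definitions, no named facts, no sorry.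
[cite: StacksProject, Tag 00UW; Tag 02NS; Tag 00I1] [cite: GortzWedhorn2020, Prop. 13.91 (2)]
-/

noncomputable section

-- single-problem summit: the doubled namespace component is forced
set_option linter.dupNamespace false

open CategoryTheory AlgebraicGeometry TopologicalSpace TensorProduct
open Literature.AlgebraicGeometry.Resolution
open Summit.ResolutionOfSingularities.ResolutionOfSingularities.Theorems.FRationalResolution

namespace Summit.ResolutionOfSingularities.ResolutionOfSingularities.Theorems.FRationalResolution.GaloisUpstairsPieceCover

/-- **Unramifiedness along a tower.** For `B → B' → C'`, `𝔔' ⊆ B'` prime over `𝔭` with `𝔭 B'_{𝔔'} = 𝔔' B'_{𝔔'}`, and `𝔚 ⊆ C'`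
prime over `𝔔'` with `𝔔' C'_𝔚 = 𝔚 C'_𝔚`: `𝔭 C'_𝔚 = 𝔚 C'_𝔚`. [cite: StacksProject, Tag 02G8] -/
theorem map_atPrime_eq_maximalIdeal_of_tower {B B' C' : Type} [CommRing B] [CommRing B'] [CommRing C'] [Algebra B B']
    [Algebra B' C'] [Algebra B C'] [IsScalarTower B B' C']
    (𝔭 : Ideal B) (𝔔' : Ideal B') [𝔔'.IsPrime] (𝔚 : Ideal C') [𝔚.IsPrime]
    (h𝔚B : 𝔚.comap (algebraMap B' C') = 𝔔')
    (hred : 𝔭.map (algebraMap B (Localization.AtPrime 𝔔')) = IsLocalRing.maximalIdeal (Localization.AtPrime 𝔔'))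
    (hunr : 𝔔'.map (algebraMap B' (Localization.AtPrime 𝔚)) = IsLocalRing.maximalIdeal (Localization.AtPrime 𝔚)) :
    𝔭.map (algebraMap B (Localization.AtPrime 𝔚)) = IsLocalRing.maximalIdeal (Localization.AtPrime 𝔚) := by
  set ℓ : Localization.AtPrime 𝔔' →+* Localization.AtPrime 𝔚 :=
    Localization.localRingHom 𝔔' 𝔚 (algebraMap B' C') h𝔚B.symm with hℓ
  have hℓB' : ℓ.comp (algebraMap B' (Localization.AtPrime 𝔔')) = algebraMap B' (Localization.AtPrime 𝔚) := by
    ext x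
    simp only [hℓ, RingHom.coe_comp, Function.comp_apply, Localization.localRingHom_to_map]
    exact (IsScalarTower.algebraMap_apply B' C' (Localization.AtPrime 𝔚) x).symm
  have hℓB : ℓ.comp (algebraMap B (Localization.AtPrime 𝔔')) = algebraMap B (Localization.AtPrime 𝔚) := by
    rw [IsScalarTower.algebraMap_eq B B' (Localization.AtPrime 𝔔'), ← RingHom.comp_assoc, hℓB',
      ← IsScalarTower.algebraMap_eq B B' (Localization.AtPrime 𝔚)]
  rw [← hunr, ← hℓB', ← Ideal.map_map, Localization.AtPrime.map_eq_maximalIdeal, ← hred, Ideal.map_map, hℓB]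

/-- **The upstairs piece with its flat chart cover and centre equation (point form).** `B` Noetherian, `C` a flat, finitely
presented, formally unramified `B`-algebra, `𝔭 ⊆ B` and `𝔔 ⊆ C` maximal with `𝔔 ∩ B = 𝔭`, `J ⊆ C` with `𝔔ⁿ ⊆ J ⊆ 𝔔` and
`Bl_J(Spec C)` regular; `B → B'` with `B'` Noetherian and `Spec B' → Spec B` smooth, `𝔔' ⊆ B'` maximal with
`𝔭 B'_{𝔔'} = 𝔔' B'_{𝔔'}` (so `𝔔'` lies over `𝔭`); and a maximal `𝔚 ⊆ C' := B' ⊗_B C` over `𝔔'` and `𝔔` with trivial residue extension over `B'`. Then there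
are `I ⊆ B'` with `𝔔'ⁿ ⊆ I ⊆ 𝔔'`, `G ∈ C'`, `G ∉ 𝔚`, with `𝔚 C'_G ⊆ 𝔭 C'_G` and `I C'_G = J C'_G`, and `h ∉ 𝔔'` with
`D(h) ⊆ im (Spec C'_G → Spec B')` and `Bl_{I B'_h}(Spec B'_h)` regular.
[cite: StacksProject, Tag 00UW; Tag 02NS; Tag 00I1] [cite: GortzWedhorn2020, Prop. 13.91 (2)] -/
theorem exists_piece_cover {B C B' : Type} [CommRing B] [CommRing C] [CommRing B'] [Algebra B C] [Algebra B B']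
    [IsNoetherianRing B] [IsNoetherianRing B'] [Module.Flat B C] [Algebra.FinitePresentation B C]
    [Algebra.FormallyUnramified B C] [Smooth (Spec.map (CommRingCat.ofHom (algebraMap B B')))]
    (𝔭 : Ideal B) [𝔭.IsMaximal] (𝔔 : Ideal C) [𝔔.IsMaximal] (h𝔔𝔭 : 𝔔.comap (algebraMap B C) = 𝔭)
    (J : Ideal C) {n : ℕ} (hJ : 𝔔 ^ n ≤ J) (hJ𝔔 : J ≤ 𝔔) (hregJ : Scheme.IsRegular (affineBlowup J))
    (𝔔' : Ideal B') [h𝔔' : 𝔔'.IsMaximal]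
    (hred : 𝔭.map (algebraMap B (Localization.AtPrime 𝔔')) = IsLocalRing.maximalIdeal (Localization.AtPrime 𝔔'))
    (𝔚 : Ideal (B' ⊗[B] C)) [h𝔚 : 𝔚.IsMaximal] (h𝔚B : 𝔚.comap (algebraMap B' (B' ⊗[B] C)) = 𝔔')
    (h𝔚C : 𝔚.comap ((Algebra.TensorProduct.includeRight : C →ₐ[B] B' ⊗[B] C) : C →+* B' ⊗[B] C) = 𝔔)
    (hres : ∀ x : B' ⊗[B] C, ∃ b' : B', x - algebraMap B' (B' ⊗[B] C) b' ∈ 𝔚) :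
    ∃ I : Ideal B', 𝔔' ^ n ≤ I ∧ I ≤ 𝔔' ∧
      ∃ G : B' ⊗[B] C, G ∉ 𝔚 ∧
        𝔚.map (algebraMap (B' ⊗[B] C) (Localization.Away G)) ≤ 𝔭.map (algebraMap B (Localization.Away G)) ∧
        I.map (algebraMap B' (Localization.Away G)) =
          (J.map ((Algebra.TensorProduct.includeRight : C →ₐ[B] B' ⊗[B] C) : C →+* B' ⊗[B] C)).map
            (algebraMap (B' ⊗[B] C) (Localization.Away G)) ∧
        ∃ h : B', h ∉ 𝔔' ∧
          (PrimeSpectrum.basicOpen h : Set (PrimeSpectrum B')) ⊆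
            Set.range (PrimeSpectrum.comap (algebraMap B' (Localization.Away G))) ∧
          Scheme.IsRegular (affineBlowup (I.map (algebraMap B' (Localization.Away h)))) := by
  classical
  set C' := B' ⊗[B] C with hC'
  set iR : C →+* C' := ((Algebra.TensorProduct.includeRight : C →ₐ[B] B' ⊗[B] C) : C →+* B' ⊗[B] C) with hiR
  haveI : Algebra.FiniteType B C := inferInstance
  haveI : IsNoetherianRing C := Algebra.FiniteType.isNoetherianRing B C
  haveI : Algebra.FiniteType B' C' := inferInstance
  haveI : IsNoetherianRing C' := Algebra.FiniteType.isNoetherianRing B' C'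
  -- (1) `𝔚` is unramified over `𝔔'` (formally unramified base change) and over `𝔭` (tower)
  have hunr' : 𝔔'.map (algebraMap B' (Localization.AtPrime 𝔚)) = IsLocalRing.maximalIdeal _ :=
    GaloisUpstairsPiece.map_eq_maximalIdeal_of_formallyUnramified 𝔔' 𝔚 h𝔚B
  have hunr𝔭 : 𝔭.map (algebraMap B (Localization.AtPrime 𝔚)) = IsLocalRing.maximalIdeal _ :=
    map_atPrime_eq_maximalIdeal_of_tower 𝔭 𝔔' 𝔚 h𝔚B hred hunr'
  -- (2) shrink the chart: over `D(G)` the fibre of `𝔭` is the reduced point `𝔚`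
  obtain ⟨G, hG, hleG⟩ := FibreReduced.exists_away_fibre_reduced 𝔭 𝔚 hunr𝔭
  set L := Localization.Away G with hL
  haveI : Algebra.FinitePresentation B' L :=
    haveI := IsLocalization.Away.finitePresentation G (S := L)
    Algebra.FinitePresentation.trans B' C' L
  haveI : Algebra.FiniteType B' L := inferInstance
  haveI : Algebra.FormallyUnramified C' L := Algebra.FormallyUnramified.of_isLocalization (Submonoid.powers G)
  haveI : Algebra.FormallyUnramified B' L := Algebra.FormallyUnramified.comp B' C' L
  have halgL : algebraMap B' L = (algebraMap C' L).comp (algebraMap B' C') := IsScalarTower.algebraMap_eq B' C' L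
  have halgBL : algebraMap B L = (algebraMap C' L).comp (algebraMap B C') := IsScalarTower.algebraMap_eq B C' L
  have hleG' : 𝔚.map (algebraMap C' L) ≤ 𝔭.map (algebraMap B L) := by rw [halgBL]; exact hleG
  set 𝔚₁ : Ideal L := 𝔚.map (algebraMap C' L) with h𝔚₁
  haveI h𝔚₁max : 𝔚₁.IsMaximal := BlowupSmoothAscent.isMaximal_map_away 𝔚 hG L
  have hdisjG : Disjoint ((Submonoid.powers G : Submonoid C') : Set C') (𝔚 : Set C') := by
    refine Set.disjoint_left.mpr ?_
    rintro x ⟨m, rfl⟩ hx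
    exact hG (h𝔚.isPrime.mem_of_pow_mem m hx)
  have h𝔚₁c : 𝔚₁.comap (algebraMap C' L) = 𝔚 :=
    IsLocalization.under_map_of_isPrime_disjoint (Submonoid.powers G) L h𝔚.isPrime hdisjG
  have h𝔚₁B : 𝔚₁.comap (algebraMap B' L) = 𝔔' := by
    rw [halgL, ← Ideal.comap_comap, h𝔚₁c, h𝔚B]
  have hover₁ : 𝔔' ≤ 𝔚₁.comap (algebraMap B' L) := h𝔚₁B.ge
  have hres₁ : ∀ x : L, ∃ b : B', x - algebraMap B' L b ∈ 𝔚₁ := by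
    intro x
    obtain ⟨b, hb⟩ := CentreDescent.residual_surjective_away 𝔚 hres G hG L x
    exact ⟨b, by rw [halgL, RingHom.comp_apply]; exact hb⟩
  have hunr₁ : 𝔔'.map (algebraMap B' (Localization.AtPrime 𝔚₁)) = IsLocalRing.maximalIdeal _ :=
    GaloisUpstairsPiece.map_eq_maximalIdeal_of_formallyUnramified 𝔔' 𝔚₁ h𝔚₁B
  -- (3) the centre on the shrunk chart: `J C'_G`
  set J₁ : Ideal L := (J.map iR).map (algebraMap C' L) with hJ₁
  have hJ₁𝔚 : J₁ ≤ 𝔚₁ := by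
    have h1 : J.map iR ≤ 𝔚 := by rw [Ideal.map_le_iff_le_comap, h𝔚C]; exact hJ𝔔
    exact Ideal.map_mono h1
  have h𝔚₁J : 𝔚₁ ^ n ≤ J₁ := by
    -- `𝔚₁ ≤ 𝔭 C'_G` and `𝔭ⁿ C'_G ≤ 𝔔ⁿ C'_G ≤ J C'_G`
    have h1 : 𝔚₁ ≤ 𝔭.map (algebraMap B L) := hleG'
    have h2 : 𝔭.map (algebraMap B C) ≤ 𝔔 := by rw [Ideal.map_le_iff_le_comap, h𝔔𝔭]
    have hjB : ((algebraMap C' L).comp iR).comp (algebraMap B C) = algebraMap B L := by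
      rw [RingHom.comp_assoc, hiR, AlgHom.comp_algebraMap, ← halgBL]
    calc 𝔚₁ ^ n ≤ (𝔭.map (algebraMap B L)) ^ n := Ideal.pow_right_mono h1 n
      _ = ((𝔭.map (algebraMap B C)) ^ n).map ((algebraMap C' L).comp iR) := by
          rw [← Ideal.map_pow (algebraMap B C) 𝔭, Ideal.map_map, hjB, Ideal.map_pow]
      _ ≤ J₁ := by
          rw [hJ₁, Ideal.map_map]
          exact Ideal.map_mono ((Ideal.pow_right_mono h2 n).trans hJ)
  have hregJ₁ : Scheme.IsRegular (affineBlowup J₁) := by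
    have h1 := BlowupTensorAscent.isRegular_affineBlowup_includeRight_of_smooth (B := B) (B'' := B') (C := C) J hregJ
    haveI : IsOpenImmersion (Spec.map (CommRingCat.ofHom (algebraMap C' L))) := IsOpenImmersion.of_isLocalization G
    exact BlowupFlatCriteria.isRegular_affineBlowup_map_of_isOpenImmersion (algebraMap C' L) _ h1
  -- (4) descend to `B'`, keeping the cover and the equation
  obtain ⟨I, hpI, hIp, g₂, hg₂, hle₂, hIJ₂, h, hh, hsub₂, hreg⟩ :=
    DescendedPrimaryPieceCover.exists_descended_primary_piece_cover 𝔔' 𝔚₁ hover₁ hres₁ hunr₁ J₁ h𝔚₁J hJ₁𝔚 hregJ₁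
  -- (5) merge the two shrinks: `(C'_G)_{g₂} ≅ C'_{G c}` for `c/1 ~ g₂`
  set T := Localization.Away g₂ with hT
  obtain ⟨c, hc⟩ : ∃ c : C', Associated (algebraMap C' L c) g₂ :=
    ⟨(IsLocalization.Away.sec G g₂).1, IsLocalization.Away.associated_sec_fst G g₂⟩
  have hc𝔚 : c ∉ 𝔚 := by
    intro hc'
    apply hg₂
    obtain ⟨u, hu⟩ := hc
    rw [← hu]
    exact Ideal.mul_mem_right _ _ (Ideal.mem_map_of_mem _ hc')
  haveI : IsLocalization.Away (G * c) T := IsLocalization.Away.mul_of_associated G c g₂ hc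
  set L' := Localization.Away (G * c) with hL'
  let e : T ≃ₐ[C'] L' := IsLocalization.algEquiv (Submonoid.powers (G * c)) T L'
  have heC : (e : T →+* L').comp (algebraMap C' T) = algebraMap C' L' := (e : T →ₐ[C'] L').comp_algebraMap
  have hTtower : algebraMap C' T = (algebraMap L T).comp (algebraMap C' L) := IsScalarTower.algebraMap_eq C' L T
  have heB' : (e : T →+* L').comp (algebraMap B' T) = algebraMap B' L' := by
    rw [IsScalarTower.algebraMap_eq B' C' T, ← RingHom.comp_assoc, heC, ← IsScalarTower.algebraMap_eq B' C' L']
  have heB : (e : T →+* L').comp (algebraMap B T) = algebraMap B L' := by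
    rw [IsScalarTower.algebraMap_eq B C' T, ← RingHom.comp_assoc, heC, ← IsScalarTower.algebraMap_eq B C' L']
  have hesymmC : ((e.symm : L' ≃ₐ[C'] T) : L' →+* T).comp (algebraMap C' L') = algebraMap C' T :=
    (e.symm : L' →ₐ[C'] T).comp_algebraMap
  have hesymmB' : ((e.symm : L' ≃ₐ[C'] T) : L' →+* T).comp (algebraMap B' L') = algebraMap B' T := by
    rw [IsScalarTower.algebraMap_eq B' C' L', ← RingHom.comp_assoc, hesymmC, ← IsScalarTower.algebraMap_eq B' C' T]
  refine ⟨I, hpI, hIp, G * c, fun hmem => (h𝔚.isPrime.mem_or_mem hmem).elim hG hc𝔚, ?_, ?_, h, hh, ?_, hreg⟩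
  · -- fibre reduced over `D(G c)`: push `𝔚 C'_G ≤ 𝔭 C'_G` along `C'_G → T ≅ C'_{G c}`
    have h1 : (𝔚.map (algebraMap C' T)) ≤ 𝔭.map (algebraMap B T) := by
      rw [hTtower, ← Ideal.map_map, IsScalarTower.algebraMap_eq B L T, ← Ideal.map_map]
      exact Ideal.map_mono hleG'
    have h2 := Ideal.map_mono (f := (e : T →+* L')) h1
    rwa [Ideal.map_map, Ideal.map_map, heC, heB] at h2
  · -- the centre equation
    have h1 := congrArg (Ideal.map (e : T →+* L')) hIJ₂
    rwa [Ideal.map_map, heB', hJ₁, Ideal.map_map, Ideal.map_map, RingHom.comp_assoc, ← hTtower, heC] at h1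
  · -- the cover
    intro x hx
    obtain ⟨y, hy⟩ := hsub₂ hx
    refine ⟨PrimeSpectrum.comap ((e.symm : L' ≃ₐ[C'] T) : L' →+* T) y, ?_⟩
    rw [← hy]
    ext1
    change Ideal.comap (algebraMap B' L') (Ideal.comap _ y.asIdeal) = Ideal.comap (algebraMap B' T) y.asIdeal
    rw [Ideal.comap_comap, hesymmB']

/-- **The upstairs piece with its flat chart cover and centre equation, from an embedding of residue fields.** As
`exists_piece_cover`, the trivial-residue point `𝔚 ⊆ B' ⊗_B C` being produced (`…TrivialResiduePoint`) from a ring map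
`ι : C/𝔔 → B'/𝔔'` compatible with `B` and returned as part of the output.
[cite: StacksProject, Tag 00UW; Tag 02NS; Tag 00I1] [cite: GortzWedhorn2020, Prop. 13.91 (2)] -/
theorem exists_piece_cover_of_residue_embedding {B C B' : Type} [CommRing B] [CommRing C] [CommRing B'] [Algebra B C]
    [Algebra B B'] [IsNoetherianRing B] [IsNoetherianRing B'] [Module.Flat B C] [Algebra.FinitePresentation B C]
    [Algebra.FormallyUnramified B C] [Smooth (Spec.map (CommRingCat.ofHom (algebraMap B B')))]
    (𝔭 : Ideal B) [𝔭.IsMaximal] (𝔔 : Ideal C) [𝔔.IsMaximal] (h𝔔𝔭 : 𝔔.comap (algebraMap B C) = 𝔭)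
    (J : Ideal C) {n : ℕ} (hJ : 𝔔 ^ n ≤ J) (hJ𝔔 : J ≤ 𝔔) (hregJ : Scheme.IsRegular (affineBlowup J))
    (𝔔' : Ideal B') [h𝔔' : 𝔔'.IsMaximal]
    (hred : 𝔭.map (algebraMap B (Localization.AtPrime 𝔔')) = IsLocalRing.maximalIdeal (Localization.AtPrime 𝔔'))
    (ι : C ⧸ 𝔔 →+* B' ⧸ 𝔔')
    (hι : ∀ b : B, ι (Ideal.Quotient.mk 𝔔 (algebraMap B C b)) = Ideal.Quotient.mk 𝔔' (algebraMap B B' b)) :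
    ∃ (𝔚 : Ideal (B' ⊗[B] C)) (_ : 𝔚.IsMaximal), 𝔚.comap (algebraMap B' (B' ⊗[B] C)) = 𝔔' ∧
      𝔚.comap ((Algebra.TensorProduct.includeRight : C →ₐ[B] B' ⊗[B] C) : C →+* B' ⊗[B] C) = 𝔔 ∧
      (∀ x : B' ⊗[B] C, ∃ b' : B', x - algebraMap B' (B' ⊗[B] C) b' ∈ 𝔚) ∧
    ∃ I : Ideal B', 𝔔' ^ n ≤ I ∧ I ≤ 𝔔' ∧
      ∃ G : B' ⊗[B] C, G ∉ 𝔚 ∧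
        𝔚.map (algebraMap (B' ⊗[B] C) (Localization.Away G)) ≤ 𝔭.map (algebraMap B (Localization.Away G)) ∧
        I.map (algebraMap B' (Localization.Away G)) =
          (J.map ((Algebra.TensorProduct.includeRight : C →ₐ[B] B' ⊗[B] C) : C →+* B' ⊗[B] C)).map
            (algebraMap (B' ⊗[B] C) (Localization.Away G)) ∧
        ∃ h : B', h ∉ 𝔔' ∧
          (PrimeSpectrum.basicOpen h : Set (PrimeSpectrum B')) ⊆
            Set.range (PrimeSpectrum.comap (algebraMap B' (Localization.Away G))) ∧
          Scheme.IsRegular (affineBlowup (I.map (algebraMap B' (Localization.Away h)))) := by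
  obtain ⟨𝔚, h𝔚max, h𝔚B, h𝔚C, hres⟩ :=
    TrivialResiduePoint.exists_trivial_residue_point (B := B) (B' := B') (C := C) 𝔔 𝔔' ι hι
  haveI := h𝔚max
  exact ⟨𝔚, h𝔚max, h𝔚B, h𝔚C, hres,
    exists_piece_cover 𝔭 𝔔 h𝔔𝔭 J hJ hJ𝔔 hregJ 𝔔' hred 𝔚 h𝔚B h𝔚C hres⟩

end Summit.ResolutionOfSingularities.ResolutionOfSingularities.Theorems.FRationalResolution.GaloisUpstairsPieceCover

end
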